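import Literature.Analysis.InnerProduct.RestrictedHilbertTensorRep
import Mathlib.Analysis.Normed.Operator.Extend
import Mathlib.Analysis.Normed.Module.Completion

/-!
# The restricted Hilbert tensor product, IV: the universal property (`lift`), uniqueness of the model, equivariance

Topic `Analysis/InnerProduct`; continues `RestrictedHilbertTensor` (`Space 𝓔 = ⊗′_i (H_i, e_i)` = completion of the
GNS pre-Hilbert space `Pre 𝓔` of the product kernel `kfun x y = ∏ᶠ_i ⟪x_i, y_i⟫` on restricted families
`x : RVec 𝓔`; total pure tensors `tp 𝓔 x = ⊗x`, `dense_span_tp`, `clm_ext`) and `RestrictedHilbertTensorRep`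
(the representation `rep hρ = ⊗′ρ_i` of `Πʳ i, [G i, B i]`, `actL`, `gact`).

* §1 THE UNIVERSAL PROPERTY. For ANY complex Hilbert space `F`, a map `Φ : RVec 𝓔 → F` REALISING THE PRODUCT
  KERNEL, `⟪Φ x, Φ y⟫ = ∏ᶠ_i ⟪x_i, y_i⟫`, extends UNIQUELY to a linear isometry
  **`lift Φ hΦ : ⊗′_i (H_i, e_i) →ₗᵢ[ℂ] F`** with **`lift_tp`** `lift Φ hΦ (⊗x) = Φ x` (GNS: `liftPre` on formal
  combinations is isometric for the GNS seminorm, `inner_liftPre`; extend to the completion, `liftL`, Mathlib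
  `ContinuousLinearMap.extend`); uniqueness `eq_lift` / `lift_unique_apply`; `range_lift` = closure of the span of the
  `Φ x`; `lift (tp 𝓔) = id` (`lift_tp_self`). This is the abstract form of the uniqueness statements of Guichardet
  (1972), App. A §A.2, PDF pp. 86–87 [Guichardet1972] ("there exists a unique isomorphism … carrying each element
  `⊗x_i` into …"): any Hilbert space generated by vectors with the Gram kernel `∏(x_i | y_i)` of loc. cit. §A.1
  receives THE isometry from `⊗′_i (H_i, e_i)`.
* §2 THE UNITARY CASE AND UNIQUENESS OF THE MODEL: `lift Φ hΦ` is onto — a unitary **`liftEquiv Φ hΦ hd :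
  Space 𝓔 ≃ₗᵢ[ℂ] F`** — as soon as the `Φ x` span a dense subspace (`surjective_lift`, `liftEquiv_tp`,
  `liftEquiv_symm_apply`); two kernel maps with total images have canonically unitarily equivalent targets
  `Φ x ↦ Φ₂ x` (**`modelEquiv`**, `modelEquiv_apply`): any two constructions of `⊗′_i (H_i, e_i)` agree.
* §3 NATURALITY (`lift_natural`) AND EQUIVARIANCE: if a unitary representation `π` of `Πʳ i, [G i, B i]` on `F`
  satisfies `π g (Φ x) = Φ (g • x)` on restricted families, then `lift Φ hΦ` intertwines `⊗′ρ_i` with `π`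
  (**`lift_rep`**, `liftEquiv_rep`, `liftEquiv_symm_rep`, `modelEquiv_rep`).

Everything is proved (Mathlib only). Continued in `RestrictedHilbertTensorFunctor` (functoriality `⊗′V_i` in the
local spaces, Guichardet App. A §A.4, and tail dependence).

## References

* A. Guichardet, *Symmetric Hilbert spaces and related topics*, LNM 261 (1972), App. A §§A.1–A.2, A.4
  [Guichardet1972] (held: `book:guichardet1972-symmetric-hilbert-spaces-related-topics`, PDF pp. 85–88).
* J. von Neumann, *On infinite direct products*, Compositio Math. 6 (1939) 1–77 [vonNeumann1939].

## Provenance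

Reproduced for the tree under the LEAN-IN-TREE rule (2026-08-18) from the pub-hodgecm cell's package files
`HodgeCM/PerL34/RestrictedTensorL2.lean` §1 (DAG-node prover #13 lineage, seat pv13-g5, gate run 30: `liftPre` …
`range_lift`, statements and proofs) and `HodgeCM/PerL34/RestrictedTensorFunctor.lean` §1 (DAG-node prover #09
lineage, seat pv09-g7, gate run 30: `kernel_tp` … `modelEquiv_rep`), verbatim up to the namespace
(`HodgeCM.PerL34.RestrictedTensor` ↦ `Literature.Analysis.InnerProduct.RestrictedTensor`) and the added docstrings;
ported by seat pv09-g9.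
-/

set_option autoImplicit false

noncomputable section

open Function Set Filter
open scoped InnerProductSpace ComplexConjugate RestrictedProduct

namespace Literature.Analysis.InnerProduct.RestrictedTensor

universe u v

variable {ι : Type u} {H : ι → Type v} [∀ i, NormedAddCommGroup (H i)]
  [∀ i, InnerProductSpace ℂ (H i)] {𝓔 : UnitFamily H}

/-! ## §1 The universal property of `⊗′_i (H_i, e_i)` -/

section Lift

variable {F : Type*} [NormedAddCommGroup F] [InnerProductSpace ℂ F]

/-- The linear map on formal combinations `Pre 𝓔 = RVec 𝓔 →₀ ℂ` induced by `Φ : RVec 𝓔 → F`. [folklore] -/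
def liftPre (Φ : RVec 𝓔 → F) : Pre 𝓔 →ₗ[ℂ] F := Finsupp.linearCombination ℂ Φ

/-- `liftPre Φ f = ∑ a • Φ x`. [folklore] -/
theorem liftPre_apply (Φ : RVec 𝓔 → F) (f : Pre 𝓔) : liftPre Φ f = f.sum fun x a => a • Φ x :=
  Finsupp.linearCombination_apply ℂ f

/-- `liftPre Φ (single x a) = a • Φ x`. [folklore] -/
@[simp] theorem liftPre_single (Φ : RVec 𝓔 → F) (x : RVec 𝓔) (a : ℂ) :
    liftPre Φ (Finsupp.single x a) = a • Φ x := by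
  rw [liftPre, Finsupp.linearCombination_single]

/-- A kernel map preserves inner products of formal combinations (for the GNS pre-inner product).
[folklore] -/
theorem inner_liftPre (Φ : RVec 𝓔 → F) (hΦ : ∀ x y, ⟪Φ x, Φ y⟫_ℂ = kfun x y) (f g : Pre 𝓔) :
    ⟪liftPre Φ f, liftPre Φ g⟫_ℂ = ⟪f, g⟫_ℂ := by
  rw [liftPre_apply, liftPre_apply, inner_pre_def]
  simp only [Finsupp.sum]
  rw [sum_inner]
  refine Finset.sum_congr rfl fun x _ => ?_
  rw [inner_sum]
  refine Finset.sum_congr rfl fun y _ => ?_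
  rw [inner_smul_left, inner_smul_right, hΦ]; ring

/-- A kernel map preserves the GNS seminorm of formal combinations. [folklore] -/
theorem norm_liftPre (Φ : RVec 𝓔 → F) (hΦ : ∀ x y, ⟪Φ x, Φ y⟫_ℂ = kfun x y) (f : Pre 𝓔) :
    ‖liftPre Φ f‖ = ‖f‖ := by
  rw [norm_eq_sqrt_re_inner (𝕜 := ℂ), norm_eq_sqrt_re_inner (𝕜 := ℂ) f, inner_liftPre Φ hΦ]

/-- The induced map on formal combinations as a linear isometry (for the GNS seminorm). [folklore] -/
def liftPreₗᵢ (Φ : RVec 𝓔 → F) (hΦ : ∀ x y, ⟪Φ x, Φ y⟫_ℂ = kfun x y) : Pre 𝓔 →ₗᵢ[ℂ] F :=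
  { liftPre Φ with norm_map' := norm_liftPre Φ hΦ }

/-- `liftPreₗᵢ` is `liftPre` as a function. [folklore] -/
@[simp] theorem liftPreₗᵢ_apply (Φ : RVec 𝓔 → F) (hΦ : ∀ x y, ⟪Φ x, Φ y⟫_ℂ = kfun x y) (f : Pre 𝓔) :
    liftPreₗᵢ Φ hΦ f = liftPre Φ f := rfl

variable [CompleteSpace F]

/-- The extension of `liftPreₗᵢ` to the completion `Space 𝓔`, as a continuous linear map. [folklore] -/
def liftL (Φ : RVec 𝓔 → F) (hΦ : ∀ x y, ⟪Φ x, Φ y⟫_ℂ = kfun x y) : Space 𝓔 →L[ℂ] F :=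
  (liftPreₗᵢ Φ hΦ).toContinuousLinearMap.extend (UniformSpace.Completion.toComplL : Pre 𝓔 →L[ℂ] Space 𝓔)

/-- The canonical map `Pre 𝓔 → Space 𝓔` has dense range. [folklore] -/
theorem denseRange_toComplL :
    DenseRange (UniformSpace.Completion.toComplL : Pre 𝓔 →L[ℂ] Space 𝓔) := by
  rw [UniformSpace.Completion.coe_toComplL]; exact UniformSpace.Completion.denseRange_coe

/-- The canonical map `Pre 𝓔 → Space 𝓔` is uniformly inducing. [folklore] -/
theorem isUniformInducing_toComplL :
    IsUniformInducing (UniformSpace.Completion.toComplL : Pre 𝓔 →L[ℂ] Space 𝓔) := by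
  rw [UniformSpace.Completion.coe_toComplL]; exact UniformSpace.Completion.isUniformInducing_coe _

/-- `liftL` restricted to formal combinations is `liftPre`. [folklore] -/
theorem liftL_coe (Φ : RVec 𝓔 → F) (hΦ : ∀ x y, ⟪Φ x, Φ y⟫_ℂ = kfun x y) (f : Pre 𝓔) :
    liftL Φ hΦ (f : Space 𝓔) = liftPre Φ f := by
  have h := ContinuousLinearMap.extend_eq (liftPreₗᵢ Φ hΦ).toContinuousLinearMap denseRange_toComplL
    isUniformInducing_toComplL f
  rw [UniformSpace.Completion.coe_toComplL] at h
  exact h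

/-- `liftL` is norm preserving. [folklore] -/
theorem norm_liftL (Φ : RVec 𝓔 → F) (hΦ : ∀ x y, ⟪Φ x, Φ y⟫_ℂ = kfun x y) (z : Space 𝓔) :
    ‖liftL Φ hΦ z‖ = ‖z‖ := by
  refine UniformSpace.Completion.induction_on z
    (isClosed_eq (liftL Φ hΦ).continuous.norm continuous_norm) fun f => ?_
  rw [liftL_coe, UniformSpace.Completion.norm_coe, norm_liftPre Φ hΦ]

/-- **The universal property of `⊗′_i (H_i, e_i)`**: a realisation `Φ` of the product kernel in a Hilbert space
`F` (`⟪Φ x, Φ y⟫ = ∏ᶠ_i ⟪x_i, y_i⟫`) extends to a linear isometry `⊗′ H →ₗᵢ[ℂ] F`, `⊗ x ↦ Φ x`.  (Abstract form of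
the uniqueness statements of Guichardet (1972) App. A §A.2: every Hilbert space generated by vectors with the Gram
kernel `∏ (x_i | y_i)` of §A.1 receives the isometry.) [folklore] -/
def lift (Φ : RVec 𝓔 → F) (hΦ : ∀ x y, ⟪Φ x, Φ y⟫_ℂ = kfun x y) : Space 𝓔 →ₗᵢ[ℂ] F :=
  { (liftL Φ hΦ).toLinearMap with norm_map' := norm_liftL Φ hΦ }

/-- `lift` is `liftL` as a function. [folklore] -/
theorem lift_apply (Φ : RVec 𝓔 → F) (hΦ : ∀ x y, ⟪Φ x, Φ y⟫_ℂ = kfun x y) (z : Space 𝓔) :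
    lift Φ hΦ z = liftL Φ hΦ z := rfl

/-- `lift Φ` on (the image of) a formal combination. [folklore] -/
theorem lift_coe (Φ : RVec 𝓔 → F) (hΦ : ∀ x y, ⟪Φ x, Φ y⟫_ℂ = kfun x y) (f : Pre 𝓔) :
    lift Φ hΦ (f : Space 𝓔) = f.sum fun x a => a • Φ x := by
  rw [lift_apply, liftL_coe, liftPre_apply]

/-- `lift Φ (⊗ x) = Φ x`. [folklore] -/
@[simp] theorem lift_tp (Φ : RVec 𝓔 → F) (hΦ : ∀ x y, ⟪Φ x, Φ y⟫_ℂ = kfun x y) (x : RVec 𝓔) :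
    lift Φ hΦ (tp 𝓔 x) = Φ x := by
  rw [tp, lift_apply, liftL_coe, liftPre_single, one_smul]

/-- Uniqueness: a continuous linear map agreeing with `Φ` on pure tensors is `lift Φ`. [folklore] -/
theorem eq_lift (Φ : RVec 𝓔 → F) (hΦ : ∀ x y, ⟪Φ x, Φ y⟫_ℂ = kfun x y) (A : Space 𝓔 →L[ℂ] F)
    (hA : ∀ x, A (tp 𝓔 x) = Φ x) : A = (lift Φ hΦ).toContinuousLinearMap :=
  clm_ext (𝓔 := 𝓔) fun x => by rw [hA, LinearIsometry.coe_toContinuousLinearMap, lift_tp]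

/-- The range of `lift Φ` is the closure of the span of the `Φ x`. [folklore] -/
theorem range_lift (Φ : RVec 𝓔 → F) (hΦ : ∀ x y, ⟪Φ x, Φ y⟫_ℂ = kfun x y) :
    (LinearMap.range (lift Φ hΦ).toLinearMap : Set F) = closure (Submodule.span ℂ (Set.range Φ) : Set F) := by
  apply le_antisymm
  · rintro _ ⟨z, rfl⟩
    have hz : z ∈ closure ((Submodule.span ℂ (Set.range (tp 𝓔)) : Submodule ℂ (Space 𝓔)) : Set (Space 𝓔)) :=
      (dense_span_tp (𝓔 := 𝓔)).closure_eq.symm ▸ Set.mem_univ z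
    have hle : (Submodule.span ℂ (Set.range (tp 𝓔))).map (lift Φ hΦ).toLinearMap ≤ Submodule.span ℂ (Set.range Φ) :=
      (Submodule.map_span_le _ _ _).2 (by
        rintro _ ⟨x, rfl⟩
        exact Submodule.subset_span ⟨x, (lift_tp Φ hΦ x).symm⟩)
    have himage : (lift Φ hΦ) '' ((Submodule.span ℂ (Set.range (tp 𝓔)) : Submodule ℂ (Space 𝓔)) : Set (Space 𝓔))
        ⊆ (Submodule.span ℂ (Set.range Φ) : Set F) := by
      rintro _ ⟨w, hw, rfl⟩
      exact hle (Submodule.mem_map_of_mem hw)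
    exact closure_mono himage (mem_closure_image (lift Φ hΦ).continuous.continuousAt hz)
  · refine (closure_minimal ?_ ?_)
    · refine Submodule.span_le.2 ?_
      rintro _ ⟨x, rfl⟩
      exact ⟨tp 𝓔 x, lift_tp Φ hΦ x⟩
    · exact (lift Φ hΦ).isometry.isClosedEmbedding.isClosed_range

end Lift

/-! ## §2 Complements: uniqueness pointwise, the unitary case, uniqueness of the model -/

section lift

variable {K : Type*} [NormedAddCommGroup K] [InnerProductSpace ℂ K] [CompleteSpace K]

/-- The pure-tensor map itself is a kernel map. [folklore] -/
theorem kernel_tp : ∀ x y : RVec 𝓔, ⟪tp 𝓔 x, tp 𝓔 y⟫_ℂ = kfun x y := inner_tp_tp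

/-- Uniqueness of the lift, pointwise form of `eq_lift`. [folklore] -/
theorem lift_unique_apply (Φ : RVec 𝓔 → K) (hΦ : ∀ x y, ⟪Φ x, Φ y⟫_ℂ = kfun x y)
    (A : Space 𝓔 →L[ℂ] K) (hA : ∀ x, A (tp 𝓔 x) = Φ x) (z : Space 𝓔) : lift Φ hΦ z = A z := by
  rw [eq_lift Φ hΦ A hA]; rfl

/-- The lift of the pure-tensor map is the identity of `⊗′ H`. [folklore] -/
theorem lift_tp_self (z : Space 𝓔) : lift (tp 𝓔) kernel_tp z = z :=
  lift_unique_apply (tp 𝓔) kernel_tp (ContinuousLinearMap.id ℂ (Space 𝓔)) (fun _ => rfl) z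

/-- `lift Φ` preserves inner products. [folklore] -/
theorem inner_lift_lift (Φ : RVec 𝓔 → K) (hΦ : ∀ x y, ⟪Φ x, Φ y⟫_ℂ = kfun x y)
    (z w : Space 𝓔) : ⟪lift Φ hΦ z, lift Φ hΦ w⟫_ℂ = ⟪z, w⟫_ℂ :=
  (lift Φ hΦ).inner_map_map z w

/-- The range of `lift Φ` is closed. [folklore] -/
theorem isClosed_range_lift (Φ : RVec 𝓔 → K) (hΦ : ∀ x y, ⟪Φ x, Φ y⟫_ℂ = kfun x y) :
    IsClosed (Set.range (lift Φ hΦ)) :=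
  (lift Φ hΦ).isometry.isClosedEmbedding.isClosed_range

/-- The span of the `Φ x` lies in the range of `lift Φ`. [folklore] -/
theorem span_range_subset_range_lift (Φ : RVec 𝓔 → K) (hΦ : ∀ x y, ⟪Φ x, Φ y⟫_ℂ = kfun x y) :
    ((Submodule.span ℂ (Set.range Φ) : Submodule ℂ K) : Set K) ⊆ Set.range (lift Φ hΦ) := by
  have h : ((Submodule.span ℂ (Set.range Φ) : Submodule ℂ K) : Set K) ⊆
      (LinearMap.range (lift Φ hΦ).toLinearMap : Set K) := by
    refine SetLike.coe_subset_coe.mpr (Submodule.span_le.mpr ?_)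
    rintro _ ⟨x, rfl⟩
    exact LinearMap.mem_range.mpr ⟨tp 𝓔 x, lift_tp Φ hΦ x⟩
  rwa [LinearMap.coe_range] at h

/-- The lift is ONTO as soon as the `Φ x` span a dense subspace of `K`. [folklore] -/
theorem surjective_lift (Φ : RVec 𝓔 → K) (hΦ : ∀ x y, ⟪Φ x, Φ y⟫_ℂ = kfun x y)
    (hd : Dense ((Submodule.span ℂ (Set.range Φ) : Submodule ℂ K) : Set K)) :
    Function.Surjective (lift Φ hΦ) := by
  have hdense : Dense (Set.range (lift Φ hΦ)) := hd.mono (span_range_subset_range_lift Φ hΦ)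
  rw [← Set.range_eq_univ, ← (isClosed_range_lift Φ hΦ).closure_eq, hdense.closure_eq]

/-- **The lift is unitary** when the `Φ x` are total: `⊗′_i (H_i, e_i) ≃ₗᵢ[ℂ] K`. [folklore] -/
def liftEquiv (Φ : RVec 𝓔 → K) (hΦ : ∀ x y, ⟪Φ x, Φ y⟫_ℂ = kfun x y)
    (hd : Dense ((Submodule.span ℂ (Set.range Φ) : Submodule ℂ K) : Set K)) :
    Space 𝓔 ≃ₗᵢ[ℂ] K :=
  LinearIsometryEquiv.ofSurjective (lift Φ hΦ) (surjective_lift Φ hΦ hd)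

/-- `liftEquiv Φ` is `lift Φ` as a function. [folklore] -/
@[simp] theorem liftEquiv_apply (Φ : RVec 𝓔 → K) (hΦ : ∀ x y, ⟪Φ x, Φ y⟫_ℂ = kfun x y)
    (hd : Dense ((Submodule.span ℂ (Set.range Φ) : Submodule ℂ K) : Set K)) (z : Space 𝓔) :
    liftEquiv Φ hΦ hd z = lift Φ hΦ z := rfl

/-- `liftEquiv Φ (⊗ x) = Φ x`. [folklore] -/
theorem liftEquiv_tp (Φ : RVec 𝓔 → K) (hΦ : ∀ x y, ⟪Φ x, Φ y⟫_ℂ = kfun x y)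
    (hd : Dense ((Submodule.span ℂ (Set.range Φ) : Submodule ℂ K) : Set K)) (x : RVec 𝓔) :
    liftEquiv Φ hΦ hd (tp 𝓔 x) = Φ x :=
  lift_tp Φ hΦ x

/-- `(liftEquiv Φ)⁻¹ (Φ x) = ⊗ x`. [folklore] -/
theorem liftEquiv_symm_apply (Φ : RVec 𝓔 → K) (hΦ : ∀ x y, ⟪Φ x, Φ y⟫_ℂ = kfun x y)
    (hd : Dense ((Submodule.span ℂ (Set.range Φ) : Submodule ℂ K) : Set K)) (x : RVec 𝓔) :
    (liftEquiv Φ hΦ hd).symm (Φ x) = tp 𝓔 x :=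
  (liftEquiv Φ hΦ hd).injective (by rw [LinearIsometryEquiv.apply_symm_apply, liftEquiv_tp])

/-! ### Naturality of the lift; uniqueness of the model -/

universe u₂ v₂

variable {ι₂ : Type u₂} {H₂ : ι₂ → Type v₂} [∀ i, NormedAddCommGroup (H₂ i)]
  [∀ i, InnerProductSpace ℂ (H₂ i)] {𝓔₂ : UnitFamily H₂}
  {K₂ : Type*} [NormedAddCommGroup K₂] [InnerProductSpace ℂ K₂] [CompleteSpace K₂]

/-- **Naturality**: if `A : ⊗′ H → ⊗′ H₂` maps pure tensors along `u` and `U : K → K₂` maps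
`Φ x ↦ Φ₂ (u x)`, then `lift Φ₂ ∘ A = U ∘ lift Φ`. [folklore] -/
theorem lift_natural (Φ : RVec 𝓔 → K) (hΦ : ∀ x y, ⟪Φ x, Φ y⟫_ℂ = kfun x y)
    (Φ₂ : RVec 𝓔₂ → K₂) (hΦ₂ : ∀ x y, ⟪Φ₂ x, Φ₂ y⟫_ℂ = kfun x y)
    {A : Space 𝓔 →L[ℂ] Space 𝓔₂} {U : K →L[ℂ] K₂} (u : RVec 𝓔 → RVec 𝓔₂)
    (hA : ∀ x, A (tp 𝓔 x) = tp 𝓔₂ (u x)) (hU : ∀ x, U (Φ x) = Φ₂ (u x)) (z : Space 𝓔) :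
    lift Φ₂ hΦ₂ (A z) = U (lift Φ hΦ z) := by
  have h : (lift Φ₂ hΦ₂).toContinuousLinearMap.comp A =
      U.comp (lift Φ hΦ).toContinuousLinearMap :=
    clm_ext fun x => by
      simp only [ContinuousLinearMap.comp_apply, LinearIsometry.coe_toContinuousLinearMap, hA,
        lift_tp, hU]
  simpa using congrArg (fun B : Space 𝓔 →L[ℂ] K₂ => B z) h

/-- **Uniqueness of the model**: two kernel maps with total images have canonically unitarily
equivalent targets, `Φ x ↦ Φ₂ x`.  (Any two constructions of `⊗′_i (H_i, e_i)` agree; cf. the unique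
isomorphisms of Guichardet (1972) App. A §A.2.) [folklore] -/
def modelEquiv (Φ : RVec 𝓔 → K) (hΦ : ∀ x y, ⟪Φ x, Φ y⟫_ℂ = kfun x y)
    (hd : Dense ((Submodule.span ℂ (Set.range Φ) : Submodule ℂ K) : Set K))
    (Φ₂ : RVec 𝓔 → K₂) (hΦ₂ : ∀ x y, ⟪Φ₂ x, Φ₂ y⟫_ℂ = kfun x y)
    (hd₂ : Dense ((Submodule.span ℂ (Set.range Φ₂) : Submodule ℂ K₂) : Set K₂)) : K ≃ₗᵢ[ℂ] K₂ :=
  (liftEquiv Φ hΦ hd).symm.trans (liftEquiv Φ₂ hΦ₂ hd₂)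

/-- `modelEquiv (Φ x) = Φ₂ x`. [folklore] -/
theorem modelEquiv_apply (Φ : RVec 𝓔 → K) (hΦ : ∀ x y, ⟪Φ x, Φ y⟫_ℂ = kfun x y)
    (hd : Dense ((Submodule.span ℂ (Set.range Φ) : Submodule ℂ K) : Set K))
    (Φ₂ : RVec 𝓔 → K₂) (hΦ₂ : ∀ x y, ⟪Φ₂ x, Φ₂ y⟫_ℂ = kfun x y)
    (hd₂ : Dense ((Submodule.span ℂ (Set.range Φ₂) : Submodule ℂ K₂) : Set K₂)) (x : RVec 𝓔) :
    modelEquiv Φ hΦ hd Φ₂ hΦ₂ hd₂ (Φ x) = Φ₂ x := by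
  rw [modelEquiv, LinearIsometryEquiv.trans_apply, liftEquiv_symm_apply, liftEquiv_tp]

/-! ## §3 Equivariance: the lift intertwines `⊗′ ρ_i` with any compatible representation on `K` -/

section equivariance

variable {G : ι → Type*} [∀ i, Group (G i)] {Sub : ι → Type*} [∀ i, SetLike (Sub i) (G i)]
  {B : ∀ i, Sub i} {ρ : ∀ i, G i →* (H i ≃ₗᵢ[ℂ] H i)} (hρ : Admissible 𝓔 B ρ)
  [∀ i, SubgroupClass (Sub i) (G i)]

/-- If `U (Φ x) = Φ (g • x)` for all restricted families `x`, then `lift (rep g z) = U (lift z)`. [folklore] -/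
theorem lift_rep_of_clm (Φ : RVec 𝓔 → K) (hΦ : ∀ x y, ⟪Φ x, Φ y⟫_ℂ = kfun x y)
    (g : Πʳ i, [G i, B i]) (U : K →L[ℂ] K) (hU : ∀ x, U (Φ x) = Φ (gact hρ g x))
    (z : Space 𝓔) : lift Φ hΦ (rep hρ g z) = U (lift Φ hΦ z) :=
  lift_natural Φ hΦ Φ hΦ (A := actL hρ g) (gact hρ g) (actL_tp hρ g) hU z

/-- **Equivariance of the lift.**  If a unitary representation `π` of `Πʳ i, [G i, B i]` on `K`
acts on the vectors `Φ x` as `⊗′ ρ_i` acts on pure tensors, `π g (Φ x) = Φ (i ↦ ρ i (g i) (x i))`,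
then `lift Φ` is an intertwiner `(⊗′ H, ⊗′ ρ) → (K, π)`. [folklore] -/
theorem lift_rep (Φ : RVec 𝓔 → K) (hΦ : ∀ x y, ⟪Φ x, Φ y⟫_ℂ = kfun x y)
    (π : (Πʳ i, [G i, B i]) →* (K ≃ₗᵢ[ℂ] K)) (hπ : ∀ g x, π g (Φ x) = Φ (gact hρ g x))
    (g : Πʳ i, [G i, B i]) (z : Space 𝓔) : lift Φ hΦ (rep hρ g z) = π g (lift Φ hΦ z) :=
  lift_rep_of_clm hρ Φ hΦ g ((π g : K ≃ₗᵢ[ℂ] K) : K →L[ℂ] K) (fun x => hπ g x) z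

/-- … and so is the unitary `liftEquiv Φ` when the `Φ x` are total. [folklore] -/
theorem liftEquiv_rep (Φ : RVec 𝓔 → K) (hΦ : ∀ x y, ⟪Φ x, Φ y⟫_ℂ = kfun x y)
    (hd : Dense ((Submodule.span ℂ (Set.range Φ) : Submodule ℂ K) : Set K))
    (π : (Πʳ i, [G i, B i]) →* (K ≃ₗᵢ[ℂ] K)) (hπ : ∀ g x, π g (Φ x) = Φ (gact hρ g x))
    (g : Πʳ i, [G i, B i]) (z : Space 𝓔) :
    liftEquiv Φ hΦ hd (rep hρ g z) = π g (liftEquiv Φ hΦ hd z) :=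
  lift_rep hρ Φ hΦ π hπ g z

/-- … in the inverse direction too. [folklore] -/
theorem liftEquiv_symm_rep (Φ : RVec 𝓔 → K) (hΦ : ∀ x y, ⟪Φ x, Φ y⟫_ℂ = kfun x y)
    (hd : Dense ((Submodule.span ℂ (Set.range Φ) : Submodule ℂ K) : Set K))
    (π : (Πʳ i, [G i, B i]) →* (K ≃ₗᵢ[ℂ] K)) (hπ : ∀ g x, π g (Φ x) = Φ (gact hρ g x))
    (g : Πʳ i, [G i, B i]) (k : K) :
    (liftEquiv Φ hΦ hd).symm (π g k) = rep hρ g ((liftEquiv Φ hΦ hd).symm k) := by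
  apply (liftEquiv Φ hΦ hd).injective
  rw [LinearIsometryEquiv.apply_symm_apply, liftEquiv_rep hρ Φ hΦ hd π hπ,
    LinearIsometryEquiv.apply_symm_apply]

/-- … hence the canonical unitary `modelEquiv` between two models with TOTAL equivariant kernel maps
intertwines the two representations: the pair `(K, π|·)` is determined up to unitary equivalence. [folklore] -/
theorem modelEquiv_rep (Φ : RVec 𝓔 → K) (hΦ : ∀ x y, ⟪Φ x, Φ y⟫_ℂ = kfun x y)
    (hd : Dense ((Submodule.span ℂ (Set.range Φ) : Submodule ℂ K) : Set K))
    (Φ₂ : RVec 𝓔 → K₂) (hΦ₂ : ∀ x y, ⟪Φ₂ x, Φ₂ y⟫_ℂ = kfun x y)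
    (hd₂ : Dense ((Submodule.span ℂ (Set.range Φ₂) : Submodule ℂ K₂) : Set K₂))
    (π : (Πʳ i, [G i, B i]) →* (K ≃ₗᵢ[ℂ] K)) (hπ : ∀ g x, π g (Φ x) = Φ (gact hρ g x))
    (π₂ : (Πʳ i, [G i, B i]) →* (K₂ ≃ₗᵢ[ℂ] K₂)) (hπ₂ : ∀ g x, π₂ g (Φ₂ x) = Φ₂ (gact hρ g x))
    (g : Πʳ i, [G i, B i]) (k : K) :
    modelEquiv Φ hΦ hd Φ₂ hΦ₂ hd₂ (π g k) = π₂ g (modelEquiv Φ hΦ hd Φ₂ hΦ₂ hd₂ k) := by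
  rw [modelEquiv, LinearIsometryEquiv.trans_apply, LinearIsometryEquiv.trans_apply,
    liftEquiv_symm_rep hρ Φ hΦ hd π hπ, liftEquiv_rep hρ Φ₂ hΦ₂ hd₂ π₂ hπ₂]

end equivariance

end lift

end Literature.Analysis.InnerProduct.RestrictedTensor
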